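import Summits.CriticalPhenomena.Ising3DConformalLimit.Theses.PersistenceSpeed
import Literature.Probability.LatticeModels.HighDimPointwiseTriviality
import Literature.Probability.LatticeModels.PointwiseScalingLimitScale

/-!
# Disproof of `U4OfBoundarySignal` — findings (crux attack at birth, stmt-CriticalPhenomena-18095)

Crux (route `PersistenceSpeed`, rank 3):
`U4OfBoundarySignal := BoundedBoundarySignal → ∀ ρ Δ S, (ρ > 0 on (0,1]) →
  HasPointwiseScalingLimit (criticalCorr 3) ρ S → IsNondegenerateTwoPoint S →
  IsTranslationInvariant S → IsScaleCovariant Δ S → HasNontrivialU4 S`.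

VERDICT: survives the birth attacks; NO unconditional kill is possible short of refuting the summit.

Findings (all kernel-checked below, axioms ⊆ {propext, Classical.choice, Quot.sound}):

1. `summit_implies_crux : Ising3DConformalLimit → U4OfBoundarySignal` (restates-summit probe
   `S → C` HOLDS). Mechanism: pointwise scaling limits of one lattice family with positive
   renormalisations and non-degenerate two-point functions are unique up to one positive scale
   (tree theorem `HasPointwiseScalingLimit.exists_scale_of_isNondegenerateTwoPoint`,
   `Literature/Probability/LatticeModels/PointwiseScalingLimitScale.lean`), and `HasNontrivialU4` is
   scale-independent (`hasNontrivialU4_iff_of_scale`). The hypotheses `BoundedBoundarySignal`,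
   `IsTranslationInvariant`, `IsScaleCovariant Δ` are NOT used.
   CONSEQUENCE `not_summit_of_not_crux`: an unconditional refutation of this crux would refute the
   summit conjunct (it needs a proof of BBS AND a Gaussian non-degenerate scaling limit of the critical
   3D Ising correlators).
2. `crux_of_no_limit`: the crux is (vacuously) implied by non-existence of a non-degenerate,
   translation-invariant, scale-covariant limit; so `C → S` FAILS short of existence (the crux does not
   restate the summit: modulo BBS it is clause (iii), uniformly over limits; existence is stmt-1344).
3. `∀` over limits ≡ `∃` once one non-degenerate limit exists (Negative lane:
   `U4OfBoundarySignalNegative.forall_limits_iff_exists_limit`).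
4. LOAD-BEARING hypothesis `IsNondegenerateTwoPoint S`: the zero family (renormalisation `ρ δ = δ`) is
   a pointwise scaling limit of `criticalCorr 3` (from `|criticalCorr| ≤ 1`), translation invariant,
   scale covariant for EVERY `Δ`, with `U₄ ≡ 0`; hence the crux with non-degeneracy dropped is
   EQUIVALENT to `¬ BoundedBoundarySignal` (`withoutND_iff_not_bbs`) — any proof must use `hnd`.
   (Negative lane: `U4OfBoundarySignalNegative.u4OfBoundarySignal_without_nondegeneracy_iff`.)
5. Not load-bearing for truth (by 1.): `hB`, `htr`, `hsc`, the value of `Δ` (the proof PLAN uses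
   them: Potter bounds / capacity order `M^{2Δ}`, `2Δ ≤ 2 < 3`). `hρ > 0` only excludes sign changes
   (even correlators unchanged) and `ρ ≡ 0` (excluded by non-degeneracy anyway).
6. Planner note (free weakening): `closes` has `IsMoebiusCovariant Δ S` and `0 < Δ` from `MoebiusLimit`
   but the crux receives only TI + SC; adding `IsRotationInvariant S` (isotropic `S₂ = c|x-y|^{-2Δ}`
   for the Slepian/capacity step) and `0 < Δ` costs the route nothing.
-/

open Literature.Probability.LatticeModels Filter Topology

namespace Summit.CriticalPhenomena.Ising3DConformalLimit.Cruxes.U4OfBoundarySignal.Disproof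

open Summit.CriticalPhenomena.Ising3DConformalLimit.Theses.PersistenceSpeed

/-! ## 1. `S → C`: the summit conjunct implies the crux -/

/-- **Non-Gaussianity is a property of the lattice family** (`d ≥ 1`): if one non-degenerate
pointwise scaling limit (positive renormalisation) has `U₄ ≢ 0`, so does every other one. -/
theorem hasNontrivialU4_of_limits {d : ℕ} (hd : 0 < d) {G : LatticeCorrFamily d} {ρ ρ' : ℝ → ℝ}
    {S S' : CorrFamily d}
    (hρ : ∀ δ ∈ Set.Ioc (0:ℝ) 1, 0 < ρ δ) (hρ' : ∀ δ ∈ Set.Ioc (0:ℝ) 1, 0 < ρ' δ)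
    (h : HasPointwiseScalingLimit G ρ S) (h' : HasPointwiseScalingLimit G ρ' S')
    (hnd : IsNondegenerateTwoPoint S) (hnd' : IsNondegenerateTwoPoint S')
    (hU : HasNontrivialU4 S) : HasNontrivialU4 S' := by
  obtain ⟨c, hc, hscale⟩ := h.exists_scale_of_isNondegenerateTwoPoint hd hρ hρ' h' hnd hnd'
  exact (hasNontrivialU4_iff_of_scale hc.ne' hscale).2 hU

/-- **Restates-summit probe `S → C` (holds).** The summit conjunct implies the crux; the
hypotheses `BoundedBoundarySignal`, translation invariance and scale covariance are unused. -/
theorem summit_implies_crux (hS : _root_.Ising3DConformalLimit) : U4OfBoundarySignal := by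
  intro _hB ρ' Δ' S' hρ' hlim' hnd' _htr _hsc
  obtain ⟨ρ, Δ, S, hρ, _hΔ, hlim, hnd, _hM, hU⟩ := hS
  exact hasNontrivialU4_of_limits (by norm_num) hρ hρ' hlim hlim' hnd hnd' hU

/-- Contrapositive: refuting the crux refutes the summit conjunct. -/
theorem not_summit_of_not_crux (h : ¬ U4OfBoundarySignal) : ¬ _root_.Ising3DConformalLimit :=
  fun hS => h (summit_implies_crux hS)

/-! ## 2. `C → S` fails short of existence: the crux is vacuously true without a limit -/

/-- If no non-degenerate, translation-invariant, scale-covariant limit exists, the crux holds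
vacuously (so the crux alone cannot give the summit, which asserts existence). -/
theorem crux_of_no_limit
    (hno : ¬ ∃ (ρ : ℝ → ℝ) (Δ : ℝ) (S : CorrFamily 3), (∀ δ ∈ Set.Ioc (0:ℝ) 1, 0 < ρ δ) ∧
      HasPointwiseScalingLimit (criticalCorr 3) ρ S ∧ IsNondegenerateTwoPoint S ∧
      IsTranslationInvariant S ∧ IsScaleCovariant Δ S) : U4OfBoundarySignal := by
  intro _hB ρ Δ S hρ hlim hnd htr hsc
  exact absurd ⟨ρ, Δ, S, hρ, hlim, hnd, htr, hsc⟩ hno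

/-! ## 4. Load-bearing analysis: non-degeneracy -/

/-- The crux with the hypothesis `IsNondegenerateTwoPoint S` dropped. -/
def U4OfBoundarySignalWithoutND : Prop :=
  BoundedBoundarySignal → ∀ (ρ : ℝ → ℝ) (Δ : ℝ) (S : CorrFamily 3),
    (∀ δ ∈ Set.Ioc (0:ℝ) 1, 0 < ρ δ) → HasPointwiseScalingLimit (criticalCorr 3) ρ S →
    IsTranslationInvariant S → IsScaleCovariant Δ S → HasNontrivialU4 S

/-- The degenerate witness: the zero family (`S 0 = ⟨1⟩`, `S n = 0` for `n ≥ 1`). -/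
noncomputable def zeroFamily : CorrFamily 3 := fun n _ => if n = 0 then criticalCorr 3 0 ![] else 0

theorem zeroFamily_translationInvariant : IsTranslationInvariant zeroFamily := by
  intro n v x; rfl

theorem zeroFamily_scaleCovariant (Δ : ℝ) : IsScaleCovariant Δ zeroFamily := by
  intro n c hc x
  by_cases hn : n = 0
  · subst hn; simp [zeroFamily]
  · simp [zeroFamily, hn]

theorem not_hasNontrivialU4_zeroFamily : ¬ HasNontrivialU4 zeroFamily := by
  rintro ⟨x, -, hx⟩
  apply hx
  simp [limitConnectedFour, zeroFamily]

/-- The zero family is a pointwise scaling limit of the critical correlators on `ℤ³` with the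
positive renormalisation `ρ δ = δ` (uses only `|criticalCorr| ≤ 1`). -/
theorem zeroFamily_isLimit : HasPointwiseScalingLimit (criticalCorr 3) (fun δ => δ) zeroFamily := by
  intro n
  apply TendstoUniformlyOn.tendstoLocallyUniformlyOn
  rw [Metric.tendstoUniformlyOn_iff]
  intro ε hε
  have hev : ∀ᶠ δ in 𝓝[>] (0:ℝ), δ ∈ Set.Ioc (0:ℝ) (min 1 (ε / 2)) :=
    Ioc_mem_nhdsGT (lt_min zero_lt_one (half_pos hε))
  filter_upwards [hev] with δ hδ x _
  obtain ⟨hδ0, hδ1⟩ := hδ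
  have hδle1 : δ ≤ 1 := hδ1.trans (min_le_left _ _)
  have hδlt : δ < ε := (hδ1.trans (min_le_right _ _)).trans_lt (half_lt_self hε)
  by_cases hn : n = 0
  · subst hn
    have hx : (fun i => latticeApprox δ (x i)) = (![] : Fin 0 → Site 3) := Subsingleton.elim _ _
    simp [rescaledCorrelator_apply, zeroFamily, hx, hε]
  · simp only [zeroFamily, hn, ↓reduceIte, rescaledCorrelator_apply, dist_zero_left, norm_mul,
      norm_pow, Real.norm_eq_abs]
    have hG := abs_criticalCorr_le_one (d := 3) le_rfl n (fun i => latticeApprox δ (x i))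
    have hδn : |δ| ^ n ≤ δ := by
      rw [abs_of_pos hδ0]
      calc δ ^ n ≤ δ ^ 1 := pow_le_pow_of_le_one hδ0.le hδle1 (Nat.one_le_iff_ne_zero.2 hn)
        _ = δ := pow_one δ
    calc |δ| ^ n * |criticalCorr 3 n fun i => latticeApprox δ (x i)| ≤ δ * 1 :=
          mul_le_mul hδn hG (abs_nonneg _) hδ0.le
      _ < ε := by rw [mul_one]; exact hδlt

/-- **Non-degeneracy is load-bearing**: with `IsNondegenerateTwoPoint S` dropped the crux is
equivalent to the NEGATION of the route's other crux `BoundedBoundarySignal` (the zero family is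
a translation-invariant, scale-covariant (every `Δ`) limit with `U₄ ≡ 0`). -/
theorem withoutND_iff_not_bbs : U4OfBoundarySignalWithoutND ↔ ¬ BoundedBoundarySignal := by
  constructor
  · intro h hB
    exact not_hasNontrivialU4_zeroFamily
      (h hB (fun δ => δ) 0 zeroFamily (fun δ hδ => hδ.1) zeroFamily_isLimit
        zeroFamily_translationInvariant (zeroFamily_scaleCovariant 0))
  · intro hnB hB
    exact absurd hB hnB

/-- Equivalently: any proof of the crux from `BoundedBoundarySignal` must use non-degeneracy. -/
theorem crux_false_without_ND (hB : BoundedBoundarySignal) : ¬ U4OfBoundarySignalWithoutND :=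
  fun h => withoutND_iff_not_bbs.1 h hB

end Summit.CriticalPhenomena.Ising3DConformalLimit.Cruxes.U4OfBoundarySignal.Disproof
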